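import Summits.BirchSwinnertonDyer.BirchSwinnertonDyer.Theorems.EisensteinPrimesBSDpOnCellCCtlLocOfFinV
import Summits.BirchSwinnertonDyer.BirchSwinnertonDyer.Theorems.EisensteinPrimesBSDpOnCellCCtlLocFinV
import Summits.BirchSwinnertonDyer.BirchSwinnertonDyer.Theorems.EisensteinPrimesBSDpOnCellCEtaleChainEndOdd
import HarnessLib

/-!
# Crux 4 `BSDpOnCellC` (stmt-BirchSwinnertonDyer-19034), line b1, stub `stub_ctlOrSwitch` — CTL-loc
# ASSEMBLED: `X2.SplitControlOnTree` at a split Eisenstein `p ‖ N` from `E(K)[p] = 0` ALONE, hence at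
# every curve with NO ℚ-rational étale `p`-line (the end of the étale isogeny chain) — the torsion
# residual of the stub is a THEOREM modulo the cited facts (cell `bsd-eis`, seat `bsd-eis-k5-c4` g5;
# THEOREMS ONLY, `--supports stmt-BirchSwinnertonDyer-19034`)

HONEST FRAMING (cell `bsd-eis`, run/shared/lean/pub/bsd-eis/): theorems only; nothing booked; X2
stays CONSTRUCTION-SHAPED; no label or count moves; closes nothing by itself (the stub
`stub_ctlOrSwitch` also needs the ℚ-rational étale CHAIN to a curve with a Manin datum, k5-c4-MEMO-2 C2,
and the crux needs `stub_c2`/`stub_c3`/`stub_mazurMC_cellB`). CONDITIONAL on the cited Poitou–Tate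
facts / GZK / modularity / Brink Thm. 2 — the SAME hypotheses BY NAME as cgshw g8's
`X2.splitControlOnTree_of_cellC_of_noPadicPTorsion`; NO hypothesis on `E(ℚ_p)[p]`.

## What this file proves (k5-c4-MEMO-2 §0 C3/C4: «CTL-loc», V1 of the REPAIR CENSUS — DONE)

* **`splitControlOnTree_of_cellC_of_noKTorsion`** — for a rank-one X2 pair `(E, p)` (`CellC W p`) with
  SPLIT multiplicative reduction at `p`: IF `E(K)[p] = 0` for every imaginary quadratic `K` in which
  `p` splits, THEN `X2.SplitControlOnTree W p`. (`…CtlLocOfFinV` + Fin_v at a split multiplicative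
  prime, `…CtlLocFinV`, both this seat.) This STRICTLY CONTAINS cgshw g8's theorem (there
  `E(ℚ_p)[p] = 0`, which implies `E(K)[p] = 0` through `K ↪ K_𝔭 = ℚ_p`).
* **`splitControlOnTree_of_cellC_of_noEtaleLine`** — the same with `E(K)[p] = 0` discharged by k5-c4
  g4's CHAIN-END LEMMA (`EtaleChainEnd.forall_torsion_eq_zero_of_no_etaleLine_of_odd`): IF `W[p]` has
  no `Γ_ℚ`-stable subgroup of order `p` fixed pointwise by the decomposition group `D_v` (`v ∋ p`) — the
  END of the ℚ-rational étale `p`-isogeny chain — THEN `X2.SplitControlOnTree W p`. This is MEMO-2's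
  proposed `stub_ctlLoc` (reshape offer C4) as a theorem: the 14/543 window classes @3 with no étale
  switch (cgshw MEMO-11 §1 (iv), referee g25) are no longer a residual of the CONTROL input; what the
  split road still needs there is the chain itself with its Manin datum (DD15 Thm. A.1 + Prop. 4.10,
  MEMO-2 C2) — or nothing, if the consumer runs the split road at the chain-end curve directly.

References: [Castella2018] Thm. 2.3 (arXiv:1704.06608 p. 5); [JetchevSkinnerWan2017] Thm. 3.3.1,
Prop. 3.3.4 Case 3(b) (arXiv:1512.06894 pp. 11–13); [KellerYin2024] App. B Thm. B.0.6 (printed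
template of control with torsion, `p ∤ N`); [GreenbergLNM1716] §3; k5-c4-MEMO-2; cgshw MEMO-7 §2c,
MEMO-11, MEMO-12.
-/

set_option autoImplicit false
-- the route's Theorems namespace `Summit.BirchSwinnertonDyer.BirchSwinnertonDyer.Theorems` (summit = problem) trips the linter
set_option linter.dupNamespace false

noncomputable section

open scoped Classical

open WeierstrassCurve NumberField IsDedekindDomain Field Literature.NumberTheory.EllipticCurves
  Literature.NumberTheory.EllipticCurves.ModularForms
  Literature.NumberTheory.EllipticCurves.GreenbergSelmer
  Literature.NumberTheory.GaloisRepresentations Literature.NumberTheory.GaloisCohomology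
  Literature.NumberTheory.EllipticCurves.Rank1Residual
  Literature.NumberTheory.Automorphic
  Summit.BirchSwinnertonDyer.Rank1Residual
  Summit.BirchSwinnertonDyer.Rank1Residual.X11b

namespace Summit.BirchSwinnertonDyer.BirchSwinnertonDyer.Theorems.CtlLoc

variable (W : WeierstrassCurve ℚ) [W.IsElliptic] [W.IsGloballyMinimal] (p : ℕ) [Fact p.Prime]

/-- **CTL-split WITH local `p`-torsion, from `E(K)[p] = 0` alone.** For a rank-one X2 pair `(E, p)`
(`X2.CellC W p`: analytic rank one, `E[p]` reducible, `p` odd multiplicative) with SPLIT multiplicative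
reduction at `p`: IF `E(K)[p] = 0` for every imaginary quadratic `K` in which `p` splits, THEN
`X2.SplitControlOnTree W p` (Cas18 Thm. 2.3 / JSW17 Thm. 3.3.1 shape at every CGLS Heegner datum, every
anticyclotomic frame), from GZK / modularity and the cited cohomological facts. Fin_v is the THEOREM
`localTowerTorsionFiniteAt_of_hasSplitMultiplicativeReductionAtPrime`. NO hypothesis `E(ℚ_p)[p] = 0`.
CONDITIONAL on the cited facts; nothing booked.
[cite: Castella2018, Thm. 2.3 (arXiv:1704.06608 p. 5)] [cite: JetchevSkinnerWan2017, Thm. 3.3.1, Prop. 3.3.4 Case 3(b) (arXiv:1512.06894 pp. 11–13)] -/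
theorem splitControlOnTree_of_cellC_of_noKTorsion
    (hGZK : rank_eq_analyticRank_of_analyticRank_le_one) (hnf : exists_isNewformOf)
    (hPT : ∀ (K : Type) [Field K] [NumberField K], poitouTate_selmerStructure_duality K)
    (hPT2 : ∀ (K : Type) [Field K] [NumberField K], poitouTate_sha_tateDual K)
    (hEP : ∀ (K : Type) [Field K] [NumberField K] (v : HeightOneSpectrum (𝓞 K)),
      localEulerPoincareCharacteristic (v.adicCompletion K))
    (hBr : ∀ (K : Type) [Field K] [NumberField K] (p : ℕ) [Fact p.Prime],
      ZpExtension.decomp_not_le_kerSubgroup_of_isAnticyclotomic K p)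
    (hc : X2.CellC W p) (hsplitW : W.HasSplitMultiplicativeReductionAtPrime p)
    (hivK : ∀ (K : Type) [Field K] [NumberField K], IsImaginaryQuadratic K → SplitsIn K p →
      ∀ Q : (W.baseChange K).toAffine.Point, p • Q = 0 → Q = 0) :
    X2.SplitControlOnTree W p :=
  splitControlOnTree_of_cellC_of_noKTorsion_of_finV W p hGZK hnf hPT hPT2 hEP hBr hc.2.1 hc hivK
    fun _ _ _ hK hs κ hκ 𝔭 h𝔭 ↦
      localTowerTorsionFiniteAt_of_hasSplitMultiplicativeReductionAtPrime W hc.2.1 hsplitW hK hs κ hκ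
        𝔭 h𝔭

/-- **CTL-loc (k5-c4-MEMO-2's `stub_ctlLoc`) as a THEOREM: the anticyclotomic control theorem at the
END of the ℚ-rational étale `p`-isogeny chain.** For a rank-one X2 pair `(E, p)` (`X2.CellC W p`) with
SPLIT multiplicative reduction at `p`, and the place `v ∋ p` of `ℚ`: IF `W[p]` admits NO subgroup of
order `p` that is `Γ_ℚ`-stable and fixed pointwise by the decomposition group `D_v` (no ÉTALE rational
`p`-line — the chain has ended; by the chain-end lemma `W(K)[p] = 0` for every imaginary quadratic `K`
with `p` split), THEN `X2.SplitControlOnTree W p`, from GZK / modularity and the cited cohomological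
facts. Together with cgshw g8's `X2.splitControlOnTree_of_cellC_of_noPadicPTorsion` (the étale-switch
end `W′(ℚ_p)[p] = 0`) this covers BOTH possible ends of the chain: the control input of the split road
holds at every chain-end curve. CONDITIONAL on the cited facts; nothing booked.
[cite: Castella2018, Thm. 2.3 (arXiv:1704.06608 p. 5)] [cite: JetchevSkinnerWan2017, Thm. 3.3.1 (arXiv:1512.06894 p. 11)]
[cite: GreenbergLNM1716, §3 Lemma 3.1 (p. 86), Lemma 3.3 (p. 87)] -/
theorem splitControlOnTree_of_cellC_of_noEtaleLine
    (hGZK : rank_eq_analyticRank_of_analyticRank_le_one) (hnf : exists_isNewformOf)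
    (hPT : ∀ (K : Type) [Field K] [NumberField K], poitouTate_selmerStructure_duality K)
    (hPT2 : ∀ (K : Type) [Field K] [NumberField K], poitouTate_sha_tateDual K)
    (hEP : ∀ (K : Type) [Field K] [NumberField K] (v : HeightOneSpectrum (𝓞 K)),
      localEulerPoincareCharacteristic (v.adicCompletion K))
    (hBr : ∀ (K : Type) [Field K] [NumberField K] (p : ℕ) [Fact p.Prime],
      ZpExtension.decomp_not_le_kerSubgroup_of_isAnticyclotomic K p)
    (hc : X2.CellC W p) (hsplitW : W.HasSplitMultiplicativeReductionAtPrime p)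
    {v : HeightOneSpectrum (𝓞 ℚ)} (hpv : ((p : ℕ) : 𝓞 ℚ) ∈ v.asIdeal)
    (hno : ¬ ∃ Φ : AddSubgroup (geomTorsion W (p : ℤ)), Nat.card Φ = p ∧
      (∀ σ : absoluteGaloisGroup ℚ, ∀ P ∈ Φ, σ • P ∈ Φ) ∧
        (∀ g ∈ decomp (K := ℚ) v, ∀ P ∈ Φ, g • P = P)) :
    X2.SplitControlOnTree W p :=
  splitControlOnTree_of_cellC_of_noKTorsion W p hGZK hnf hPT hPT2 hEP hBr hc hsplitW
    fun _ _ _ hK hs ↦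
      EtaleChainEnd.forall_torsion_eq_zero_of_no_etaleLine_of_odd W p hc.2.1 hK hs hpv hno

end Summit.BirchSwinnertonDyer.BirchSwinnertonDyer.Theorems.CtlLoc

end
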